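import Summits.AtomisticToContinuum.HydrodynamicLimit.Theorems.OneFlightGossipEngineKineticCurrentsWindowLDUniformLedgerAssemblyDuality
import Literature.MathematicalPhysics.KineticTheory.HardSphereTwoTimePressure
import Literature.MathematicalPhysics.KineticTheory.HardSphereEulerProofs
import Literature.Analysis.FluidPDE.HardSphereFlowJointMeasurable

/-!
# The perturbative entropy normal form of `EquilibriumFastWindowLD` is lossless
(crux stmt-AtomisticToContinuum-14440, line `Sketch`, skeleton rev 5; lead c3)

Skeleton rev 5 of the line `Sketch` splits the bounded-class window LD `W` (the crux
`TwoClocks.EquilibriumFastWindowLD` restricted to the class `𝒢(C')` of continuous, compactly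
`v`-supported, Maxwellian-centred one-body observables, with a class-uniform tilt range; the
hypothesis of the landed `EquilibriumFastWindowLD_of_boundedWindowLD`) as
`W ⟸ stub_tiltDuality (stub_perturbativeRelaxation)`, where the open stub `P :=
stub_perturbativeRelaxation` is the ENTROPY-LINEAR form: for every probability law `Q ≪ G_N` of
relative entropy `H(Q | G_N) ≤ s₀ (N+1)`,
`β₁ · E_Q[S^G_{N,τ}] ≤ H(Q | G_N) + ε (N+1)` eventually in `N`
(`S^G_{N,τ}(z) = Σᵢ w⁻¹∫₀ʷ G((Φ_N.flow r z)ᵢ) dr`, `w = τ (N+1)^{-1/3}`), and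
`stub_tiltDuality : P → W` is landed (p127451).

This file proves the converse `W → P` (`perturbativeRelaxation_of_boundedWindowLD`): the easy half
of the Donsker–Varadhan variational formula (`LedgerAssembly.integral_le_of_exp_moment`) applied to
the window exponential moment of `W` at the tilt `β₁` itself. Hence `P ⟺ W` over the landed
statics: the rev-5 normal form neither loses nor gains strength — the open stub is exactly the
crux restricted to the bounded class (the "fixed-density wall" minus statics), in the currency
(relative entropy of perturbations of the global Gibbs state) in which a dynamical proof would be
written. The entropy radius `s₀` plays no role in this direction (any `s₀ > 0` works; we take `1`).
-/

noncomputable section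

open MeasureTheory ProbabilityTheory Real Set Filter InformationTheory
open scoped ENNReal BigOperators

namespace Summit.AtomisticToContinuum.HydrodynamicLimit.Theorems.FastWindowRG

open Literature.Analysis.FluidPDE Literature.MathematicalPhysics.KineticTheory

open Summit.AtomisticToContinuum.HydrodynamicLimit.Theorems.KineticCurrentsWindowLDUniformGossip in
/-- **Donsker–Varadhan, packaged for the window functional.** On a probability space, if
`∫⁻ e^{β₁ S} dμ ≤ e^{B}` with `β₁ > 0` and `S` a.e.-strongly-measurable under every `Q ≪ μ`
considered, then for every probability law `Q ≪ μ` of finite relative entropy under which `S` is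
integrable, `β₁ ∫ S dQ ≤ H(Q | μ) + B`. -/
theorem mul_integral_le_klDiv_add_of_lintegral_exp_le {Ω : Type*} [MeasurableSpace Ω]
    {μ : Measure Ω} [IsProbabilityMeasure μ] {S : Ω → ℝ} (hSm : AEStronglyMeasurable S μ)
    {β₁ B : ℝ} (hβ₁ : 0 < β₁)
    (hexp : ∫⁻ ω, ENNReal.ofReal (Real.exp (β₁ * S ω)) ∂μ ≤ ENNReal.ofReal (Real.exp B))
    {Q : Measure Ω} [IsProbabilityMeasure Q] (hfin : klDiv Q μ ≠ ∞) (hSQ : Integrable S Q) :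
    β₁ * ∫ ω, S ω ∂Q ≤ (klDiv Q μ).toReal + B := by
  obtain ⟨hint, hle⟩ :=
    LedgerAssembly.integrable_exp_of_lintegral_le (μ := μ) (g := fun ω => β₁ * S ω)
      (hSm.const_mul β₁) hexp
  have h := LedgerAssembly.integral_le_of_exp_moment hfin hSQ hβ₁ hint hle
  rw [le_div_iff₀ hβ₁] at h
  linarith [h]

/-- **The rev-5 normal form is lossless: `W → P`.** The bounded-class window LD with a
class-uniform tilt range implies the perturbative entropy-linear relaxation bound (with the same
rate `β₁` and any entropy radius, here `s₀ = 1`): given `G ∈ 𝒢(C')` and `ε`, take the window and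
threshold of `W` at the tilt `β₁` itself and apply the Donsker–Varadhan inequality
`β₁ E_Q[S] ≤ H(Q | G_N) + log ∫ e^{β₁ S} dG_N ≤ H(Q | G_N) + ε (N+1)`. Together with the landed
`stub_tiltDuality : P → W` (p127451) this shows `P ⟺ W`. -/
theorem perturbativeRelaxation_of_boundedWindowLD :
    (∃ σ₀ : ℝ, 0 < σ₀ ∧ ∀ (a₀ θ₀ : ℝ) (u₀ : V3), 0 < a₀ → 0 < θ₀ → ∀ σ : ℝ, 0 < σ → σ < σ₀ →
      ∀ Φ : (N : ℕ) → HardSphereFlow (Torus.geometry (Fin 3)) (hsDiameter σ N) (N + 1),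
      ∀ C' : ℝ, 0 ≤ C' → ∃ β₁ : ℝ, 0 < β₁ ∧
      ∀ G : T3 × V3 → ℝ, Continuous G → (∀ y, |G y| ≤ C' * (1 + ‖y.2‖ ^ 2)) →
      (∃ R : ℝ, ∀ y : T3 × V3, R ≤ ‖y.2‖ → G y = 0) →
      (∀ x, ∫ v, G (x, v) * localMaxwellian 1 θ₀ u₀ v = 0) →
      (∀ x (j : Fin 3), ∫ v, G (x, v) * v j * localMaxwellian 1 θ₀ u₀ v = 0) →
      (∀ x, ∫ v, G (x, v) * ‖v‖ ^ 2 * localMaxwellian 1 θ₀ u₀ v = 0) →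
      ∀ β : ℝ, |β| ≤ β₁ → ∀ ε : ℝ, 0 < ε → ∃ τ : ℝ, 0 < τ ∧ ∃ N₀ : ℕ, ∀ N : ℕ, N₀ ≤ N →
        ∫⁻ z, ENNReal.ofReal (Real.exp (β * ∑ i : Fin (N + 1),
            (τ * ((N : ℝ) + 1) ^ (-(1 / 3 : ℝ)))⁻¹ *
              ∫ r in (0 : ℝ)..(τ * ((N : ℝ) + 1) ^ (-(1 / 3 : ℝ))), G (((Φ N).flow r z) i)))
          ∂(localGibbsLaw σ (fun _ => a₀) (fun _ => u₀) (fun _ => θ₀) N (Φ N)) ≤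
          ENNReal.ofReal (Real.exp (ε * ((N : ℝ) + 1)))) →
    ∃ σ₀ : ℝ, 0 < σ₀ ∧ ∀ (a₀ θ₀ : ℝ) (u₀ : V3), 0 < a₀ → 0 < θ₀ → ∀ σ : ℝ, 0 < σ → σ < σ₀ →
      ∀ Φ : (N : ℕ) → HardSphereFlow (Torus.geometry (Fin 3)) (hsDiameter σ N) (N + 1),
      ∀ C' : ℝ, 0 ≤ C' → ∃ β₁ : ℝ, 0 < β₁ ∧ ∃ s₀ : ℝ, 0 < s₀ ∧
      ∀ G : T3 × V3 → ℝ, Continuous G → (∀ y, |G y| ≤ C' * (1 + ‖y.2‖ ^ 2)) →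
      (∃ R : ℝ, ∀ y : T3 × V3, R ≤ ‖y.2‖ → G y = 0) →
      (∀ x, ∫ v, G (x, v) * localMaxwellian 1 θ₀ u₀ v = 0) →
      (∀ x (j : Fin 3), ∫ v, G (x, v) * v j * localMaxwellian 1 θ₀ u₀ v = 0) →
      (∀ x, ∫ v, G (x, v) * ‖v‖ ^ 2 * localMaxwellian 1 θ₀ u₀ v = 0) →
      ∀ ε : ℝ, 0 < ε → ∃ τ : ℝ, 0 < τ ∧ ∃ N₀ : ℕ, ∀ N : ℕ, N₀ ≤ N →
        ∀ Q : Measure (Config (N + 1) (Fin 3) T3), IsProbabilityMeasure Q →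
          Q ≪ localGibbsLaw σ (fun _ => a₀) (fun _ => u₀) (fun _ => θ₀) N (Φ N) →
          klDiv Q (localGibbsLaw σ (fun _ => a₀) (fun _ => u₀) (fun _ => θ₀) N (Φ N)) ≤
            ENNReal.ofReal (s₀ * ((N : ℝ) + 1)) →
          β₁ * ∫ z, (∑ i : Fin (N + 1), (τ * ((N : ℝ) + 1) ^ (-(1 / 3 : ℝ)))⁻¹ *
              ∫ r in (0 : ℝ)..(τ * ((N : ℝ) + 1) ^ (-(1 / 3 : ℝ))), G (((Φ N).flow r z) i)) ∂Q ≤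
            (klDiv Q (localGibbsLaw σ (fun _ => a₀) (fun _ => u₀) (fun _ => θ₀) N (Φ N))).toReal +
              ε * ((N : ℝ) + 1) := by
  rintro ⟨σ₀, hσ₀, hW⟩
  refine ⟨min σ₀ (1 / 2), lt_min hσ₀ (by norm_num), ?_⟩
  intro a₀ θ₀ u₀ ha hθ σ hσ hσ' Φ C' hC'
  have hσ1 : σ < σ₀ := hσ'.trans_le (min_le_left _ _)
  have hσ2 : σ ≤ 1 / 2 := (hσ'.trans_le (min_le_right _ _)).le
  obtain ⟨β₁, hβ₁, hWG⟩ := hW a₀ θ₀ u₀ ha hθ σ hσ hσ1 Φ C' hC'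
  refine ⟨β₁, hβ₁, 1, one_pos, ?_⟩
  intro G hG hGC hGR h1 hv h2 ε hε
  obtain ⟨τ, hτ, N₀, hN₀⟩ := hWG G hG hGC hGR h1 hv h2 β₁ (abs_of_pos hβ₁).le ε hε
  refine ⟨τ, hτ, N₀, fun N hN Q hQ hQac hQkl => ?_⟩
  set μ := localGibbsLaw σ (fun _ => a₀) (fun _ => u₀) (fun _ => θ₀) N (Φ N) with hμ
  haveI : IsProbabilityMeasure μ := isProbabilityMeasure_localGibbsLaw (a₀ := fun _ => a₀)
    (θ₀ := fun _ => θ₀) (u₀ := fun _ => u₀) continuous_const continuous_const continuous_const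
    (fun _ => ha) (fun _ => hθ) hσ2 N (Φ N)
  set w : ℝ := τ * ((N : ℝ) + 1) ^ (-(1 / 3 : ℝ)) with hwdef
  have hw : 0 < w := mul_pos hτ (Real.rpow_pos_of_pos (by positivity) _)
  set S : Config (N + 1) (Fin 3) T3 → ℝ :=
    fun z => ∑ i : Fin (N + 1), w⁻¹ * ∫ r in (0 : ℝ)..w, G (((Φ N).flow r z) i) with hSdef
  -- both laws are carried by the good set
  have hgood : μ (Φ N).goodᶜ = 0 :=
    (localGibbsLaw_absolutelyContinuous σ _ _ _ N (Φ N)) (Φ N).measure_compl_good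
  have hgoodQ : Q (Φ N).goodᶜ = 0 := hQac hgood
  have hSmeas : ∀ ν : Measure (Config (N + 1) (Fin 3) T3), ν (Φ N).goodᶜ = 0 →
      AEStronglyMeasurable S ν := fun ν hν => by
    refine (Finset.aemeasurable_fun_sum _ fun i _ => ?_).aestronglyMeasurable
    exact ((Φ N).aemeasurable_intervalIntegral_comp_flow_torus
      (hG.measurable.comp (measurable_pi_apply i)) 0 w hν).const_mul _
  -- `G` is bounded, hence so is `S`
  obtain ⟨R, hR⟩ := hGR
  have hGM : ∀ y, |G y| ≤ C' * (1 + R ^ 2) := fun y => by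
    rcases le_or_gt R ‖y.2‖ with hy | hy
    · rw [hR y hy, abs_zero]
      positivity
    · refine (hGC y).trans (mul_le_mul_of_nonneg_left ?_ hC')
      nlinarith [norm_nonneg y.2]
  have hSB : ∀ z, |S z| ≤ ((N : ℝ) + 1) * (C' * (1 + R ^ 2)) := fun z => by
    have hterm : ∀ i : Fin (N + 1),
        |w⁻¹ * ∫ r in (0 : ℝ)..w, G (((Φ N).flow r z) i)| ≤ C' * (1 + R ^ 2) := by
      intro i
      have hint : ‖∫ r in (0 : ℝ)..w, G (((Φ N).flow r z) i)‖ ≤ C' * (1 + R ^ 2) * |w - 0| :=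
        intervalIntegral.norm_integral_le_of_norm_le_const fun r _ => by
          rw [Real.norm_eq_abs]
          exact hGM _
      rw [Real.norm_eq_abs, sub_zero, abs_of_pos hw] at hint
      rw [abs_mul, abs_of_pos (inv_pos.2 hw)]
      calc w⁻¹ * |∫ r in (0 : ℝ)..w, G (((Φ N).flow r z) i)| ≤ w⁻¹ * (C' * (1 + R ^ 2) * w) :=
            mul_le_mul_of_nonneg_left hint (inv_pos.2 hw).le
        _ = C' * (1 + R ^ 2) := by
            rw [mul_comm, mul_assoc, mul_inv_cancel₀ hw.ne', mul_one]
    calc |S z| ≤ ∑ i, |w⁻¹ * ∫ r in (0 : ℝ)..w, G (((Φ N).flow r z) i)| :=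
          Finset.abs_sum_le_sum_abs _ _
      _ ≤ ∑ _i : Fin (N + 1), C' * (1 + R ^ 2) := Finset.sum_le_sum fun i _ => hterm i
      _ = ((N : ℝ) + 1) * (C' * (1 + R ^ 2)) := by
          rw [Finset.sum_const, Finset.card_univ, Fintype.card_fin, nsmul_eq_mul]
          push_cast
          ring
  -- integrability of `S` under `Q` (bounded and a.e.-strongly-measurable)
  have hSQ : Integrable S Q :=
    (integrable_const (((N : ℝ) + 1) * (C' * (1 + R ^ 2)))).mono' (hSmeas Q hgoodQ)
      (ae_of_all _ fun z => (Real.norm_eq_abs _).trans_le (hSB z))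
  -- finite relative entropy
  have hfin : klDiv Q μ ≠ ∞ := ne_top_of_le_ne_top ENNReal.ofReal_ne_top hQkl
  -- Donsker–Varadhan at the tilt `β₁` against the window bound of `W`
  exact mul_integral_le_klDiv_add_of_lintegral_exp_le (hSmeas μ hgood) hβ₁ (hN₀ N hN) hfin hSQ

end Summit.AtomisticToContinuum.HydrodynamicLimit.Theorems.FastWindowRG

end
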